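import Mathlib.Analysis.Normed.Module.Alternating.Basic
import Mathlib.Data.Fin.VecNotation
import HarnessLib

/-!
# Two Hamiltonian vector fields of proportional Hamiltonians are proportional (pointwise algebra)

Topic `Literature/Geometry/Symplectic`; a pointwise linear-algebra lemma of the fact seat of
`Literature.Geometry.Symplectic.mclean_divisorComplement_convex_four` (M. McLean, GAFA 22 (2012),
Lemma 5.17; p. 37: "`X_{ν(r)} = -(ν'(r)/r) ∂_ϑ`").  For a non-degenerate alternating bilinear
form `s` on `E` (the symplectic form at a point, tree convention `ι_X ω = dH`), if
`s(X, ·) = a` and `s(u, ·) = c · a` for a functional `a`, then `u = c • X`; in particular the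
Hamiltonian vector field `u = X_{r²}` (`s(u, ·) = d(r²)`) of the squared radius is `-2 X` when the
rotation `X` is generated by `-r²/2` (`s(X, ·) = -½ d(r²)`), which converts the normal form
`(θ - dh)(X) = κ + r²/2` of `CircleActionPrimitiveNormalForm.lean` into the positivity input
`(θ - dh)(X_{r²}) = -(r² + 2κ)` of `McleanDivisorComplementConvexFourGluing.lean`.

Everything is proved; no definitions, no named facts (D-0026).

## References

* M. McLean, *The growth rate of symplectic homology and affine varieties*, Geom. Funct. Anal. 22
  (2012), p. 37. [Mclean2012]
-/

noncomputable section

namespace Literature.Geometry.Symplectic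

variable {E : Type*} [NormedAddCommGroup E] [NormedSpace ℝ E]

/-- **Non-degeneracy determines the Hamiltonian vector field**: if `s(X, w) = a(w)` and
`s(u, w) = c · a(w)` for all `w`, with `s` non-degenerate, then `u = c • X`. [folklore] -/
theorem eq_smul_of_forall_apply_eq (s : E [⋀^Fin 2]→L[ℝ] ℝ)
    (hnd : ∀ v : E, v ≠ 0 → ∃ w : E, s ![v, w] ≠ 0) {X u : E} {a : E → ℝ} {c : ℝ}
    (hX : ∀ w, s ![X, w] = a w) (hu : ∀ w, s ![u, w] = c * a w) : u = c • X := by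
  by_contra hne
  obtain ⟨w, hw⟩ := hnd (u - c • X) (sub_ne_zero.2 hne)
  apply hw
  have hlin : s ![u - c • X, w] = s ![u, w] - c * s ![X, w] := by
    have h1 : (![u - c • X, w] : Fin 2 → E) = Function.update ![u, w] 0 (u - c • X) := by
      funext i; fin_cases i <;> rfl
    have h2 : (![u, w] : Fin 2 → E) = Function.update ![u, w] 0 u := by
      funext i; fin_cases i <;> rfl
    have h3 : (![X, w] : Fin 2 → E) = Function.update ![u, w] 0 X := by
      funext i; fin_cases i <;> rfl
    rw [h1, s.map_update_sub, s.map_update_smul, ← h2, ← h3, smul_eq_mul]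
  rw [hlin, hu, hX, sub_self]

/-- **`X_{r²} = -2 X` when the rotation `X` is generated by `-r²/2`**: with the tree's
convention `ι_X ω = dH`, if `s(X, w) = -½ ρ(w)` and `s(u, w) = ρ(w)` for all `w` (`ρ = d(r²)`),
then `u = -2 • X` (McLean 2012, p. 37). [cite: Mclean2012, Lemma 5.17 (proof)] -/
theorem eq_neg_two_smul_of_momentMap (s : E [⋀^Fin 2]→L[ℝ] ℝ)
    (hnd : ∀ v : E, v ≠ 0 → ∃ w : E, s ![v, w] ≠ 0) {X u : E} {ρ : E → ℝ}
    (hX : ∀ w, s ![X, w] = -(1 / 2) * ρ w) (hu : ∀ w, s ![u, w] = ρ w) : u = (-2 : ℝ) • X := by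
  refine eq_smul_of_forall_apply_eq s hnd hX fun w ↦ ?_
  rw [hu w]
  ring

/-- The value of a `1`-form on `X_{r²}` from its value on the rotation: if `u = -2 • X` and
`l(X) = κ + r/2` then `l(u) = -(r + 2κ)` (the positivity input of the gluing step is
`0 < -(r² + 2κ)`, i.e. `r² < -2κ`, `κ < 0`). [cite: Mclean2012, Lemma 5.17 (proof)] -/
theorem apply_eq_neg_of_eq_neg_two_smul (l : E [⋀^Fin 1]→L[ℝ] ℝ) {X u : E} {κ r : ℝ}
    (hu : u = (-2 : ℝ) • X) (hl : l ![X] = κ + r / 2) : l ![u] = -(r + 2 * κ) := by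
  have hlin : l ![(-2 : ℝ) • X] = (-2 : ℝ) * l ![X] := by
    have h1 : (![(-2 : ℝ) • X] : Fin 1 → E) = Function.update ![X] 0 ((-2 : ℝ) • X) := by
      funext i; fin_cases i; rfl
    have h2 : (![X] : Fin 1 → E) = Function.update ![X] 0 X := by
      funext i; fin_cases i; rfl
    rw [h1, l.map_update_smul, ← h2, smul_eq_mul]
  rw [hu, hlin, hl]
  ring

end Literature.Geometry.Symplectic
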